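import Mathlib
import Summits.Ventures.FusionMHD.Models.CerfonFreidbergIterLikeQ90Defs
import HarnessLib

/-!
# Ventures/FusionMHD — Models/CerfonFreidbergIterLikeQ90Panels6.lean: KERNEL CHECK of panels 19, 20 (of 32) of the
# certified safety factor `q(ψ_N = 9/10)/F` of THE Cerfon–Freidberg ITER-like instance (sibling of `…IterLikeQHalfPanels*.lean`)

HONEST FRAMING (LADDER-GRIDFUSION three columns; CF rung, F2 item R2, q-profile sample).  One `decide +kernel` (≈ 86 s on the farm): for
each panel `j` listed, the per-panel obligation `CFIterLike.Q90.PanelCert.ok` (`Models/CerfonFreidbergIterLikeQ90Defs.lean`) — the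
Taylor-model run of `CFIterLike.Q90.progG` over the ITER-like parameter box is ACCEPTED (every `log`/`sin`/`cos` composition and the `inv`
certificate), and the kernel's panel-integral enclosure of the polar `(6.35)` integrand along the approximant, the range of the flux residual
`U(ray m) − U_a/10`, the range of the approximant `m` and the range of the radial derivative `D_r(θ, m)` lie inside the integers claimed in
`panelCert6` (values read off a compiled `#eval` of the same functions, slack one unit of `2⁻⁶⁰`; probe `QProbeIF*.lean`, generator
`pub/gridfusion/models/gen-model-5/g8/gen90/mkdefsN.py`).  What these Booleans MEAN (real-number statements, uniformly over the parameter box ∋ THE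
ITER-like instance) is proved once in `Models/CerfonFreidbergIterLikeQ90Sound.lean`.  MODELLED: analytic Cerfon–Freidberg family; `q` of a
MODEL surface — nothing about a device or stability.  No `native_decide`.  Typer/prover: gridfusion-model-5 (g8), 2026-08-27.
Citations: Freidberg 2014 §6.3.5 (6.35) [Freidberg2014]; Mahboubi–Melquiond–Sibut-Pinote 2016 §3.2 Lemma 3 [MahboubiMelquiondSibutpinote2016].
-/

namespace Summit.Ventures.FusionMHD.Models.CFIterLike.Q90

/-- The certificate data of panels 19, 20 (`ψ_N = 9/10`): `inv` candidate (degree-12 fit of `(X·D_r)⁻¹` in the panel variable, scaled by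
`2⁶⁰`), Taylor degree, `inv` widening `2^elog2`, and the claimed integral / residual / `m`-range / `D_r`-range integers (× `2⁶⁰`). [instance data] -/
def panelCert6 : List PanelCert := [
  { j := 19, cand := [14262525670436958208, 55679092166105038848, -369448849804671188992, -3732305247337462104064, 14891075103246568652800, 271368466404152757452800, -418377290592377787908096, -19400863399461898357309440, -12164773012219342557806592, 1340151931603164699436253184, 3727317645763773878117597184, -84306952080966892938577575936, -425701247604381673919078203392],
    deg := 12, elog2 := 37, plo := 742861506283951836, phi := 742861521464904221, eta := 102416595, mlo := 611117902033173851, mhi := 616226966292492893,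
    dlo := 103209759318368497, dhi := 111996220217560936 },
  { j := 20, cand := [15549168549168832512, 24572768236282519552, -566321974577091772416, -40564559010969509888, 34475211784212472397824, -77351842359281025286144, -2088252326884728832524288, 10338918139870285169426432, 118341394857009487624011776, -1017344749573996023050665984, -5790008495523623656650440704, 82208142618341228998251511808, 178702066052308136509321510912],
    deg := 12, elog2 := 37, plo := 798561456216788526, phi := 798561471342704957, eta := 91065174, mlo := 595403326397919892, mhi := 615757246665680956,
    dlo := 103277523828579051, dhi := 105004352745426492 }]

/-- **KERNEL CHECK** of panels 19, 20 of the ITER-like surface `ψ_N = 9/10`. -/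
theorem panelCert6_ok : CFIterLike.Q90.panelCert6.all PanelCert.ok = true := by
  decide +kernel

end Summit.Ventures.FusionMHD.Models.CFIterLike.Q90
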